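/-
Copyright (c) 2026 the pub-hodgecm2 formalisation cell (harness21).  New file.
Origin: seat `prover-pub-hodgecm2-item6-p2-g10-0` (unit pub-hodgecm2-item6-p2, TRANSPOSITION item (vi) extra prover p2, gen 10),
2026-08-21 — the (J3) PLACEMENT JUNCTION adapter ALONG A GROUP IDENTIFICATION (b01-idea-1 IDEA-1ad F2 «GROUP PIN», HOME/INBOX
l.6023; kernel text of §0/§1 adapted from b01-idea-1's `HOME/b01/IDEA-1ad-Sketch.lean` md5 bb145b3f7060, farm rc 0; coordinator
ruling HODGE post-Δ2 22:05:29Z (2), X3 carrier «G ↔ V.adelicFin»).  Sibling of `Item6PlacementJunction.lean` (p305984) and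
`Item6PlacementJunctionTransport.lean`.  KERNEL only: theorems, no `def`, no cited record beyond the displayed binders; count-neutral;
HC_CM is NOT proved; nothing here is a claim of the manuscripts under adjudication.
-/
import Summits.HodgeConjecture.CorCM.B01.Transposition.Item6PlacementJunction
import Mathlib.Topology.Algebra.ContinuousMonoidHom
import HarnessLib

set_option autoImplicit false

/-!
# (J3) along a group identification `eG : D.G ≃ₜ* G'`

The junction's adapter `thm418Realised_of_asPrinted` (p305984 :222) and its map form (`Item6PlacementJunctionTransport`) type the
package record as `T : LiuAlbaneseModuleDatum D.G Kof` — the record's group IS Liu's `𝔾(𝔸_F^∞)` by `rfl`.  At the package pin the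
record is `LiuCarriers V := LiuAlbaneseModuleDatum ↥V.adelicFin Level.K` (package `Model/LiuDictionary.lean` :146) while a posited
as-printed datum `D` carries its own group field `D.G`; Liu FIXES an identification `𝔾(𝔸_F^∞) ≅ U(V)(𝔸_F^∞)` ([Liu2021] App. C,
`FJcycle.tex` l. 4624; the tree's `Thm418Data.G` docstring).  This file re-types the adapter for a record over ANY topological group
`G'` with a DISPLAYED `eG : D.G ≃ₜ* G'` (X3 carrier «G ↔ V.adelicFin» of the coordinator's post-Δ2 ruling): Liu's `Hom`-modules are
read at the pulled-back levels `eG⁻¹(Kof K)`, the `G`-actions through `of (eG g)`.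

* §0 `isOpenCompact_comap`, `isOpenCompact_map`, `cofinal_comap` — open-compact / cofinal level families transport along `eG`;
* §1 `thm418Realised_of_asPrinted_along` — «Thm. 4.18 realised at `μ`» for `T` over `G'`, `ψ` an injective equivariant `ℂ`-linear map;
* §2 `exists_sumEmbedding_along`, `thm418Realised_of_asPrinted_along_summands` — the same from PER-SUMMAND identifications
  `σ : T.Adm μ → D.AdmIndex` (injective), `e a : T.Ω μ a ≃ₗ[ℂ] D.omegaAt (σ a)` equivariant along `eG`.

At `G' := D.G`, `eG := ContinuousMulEquiv.refl _` these are the Transport file's statements up to `Subgroup.comap id`.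
All `[folklore]` plumbing around pin-3's `Thm418Data.resW_mem_span_of_fixed_of_thm418AsPrinted_act`; HC_CM is NOT proved; no pin is
discharged here.
-/

noncomputable section

open scoped DirectSum TensorProduct

namespace HodgeCM.Literature.Theta

namespace LiuAlbaneseModuleDatum

open Literature.NumberTheory.Automorphic.Liu2021 NumberField

universe v w

/-! ## §0. Open-compact subgroups and cofinal level families along a topological group isomorphism -/

section OpenCompact

variable {G G' : Type} [Group G] [Group G'] [TopologicalSpace G] [TopologicalSpace G']

/-- The pull-back of an open compact subgroup along `e : G ≃ₜ* G'` is open compact. [folklore] -/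
theorem isOpenCompact_comap (e : G ≃ₜ* G') {K : Subgroup G'} (hK : IsOpenCompact K) :
    IsOpenCompact (K.comap e.toMulEquiv.toMonoidHom) := by
  let h : G ≃ₜ G' := e.toHomeomorph
  have hset : ((K.comap e.toMulEquiv.toMonoidHom : Subgroup G) : Set G) = h ⁻¹' (K : Set G') := rfl
  refine ⟨?_, ?_⟩
  · rw [hset]; exact h.isOpen_preimage.2 hK.1
  · rw [hset]; exact h.isCompact_preimage.2 hK.2

/-- The push-forward of an open compact subgroup along `e : G ≃ₜ* G'` is open compact. [folklore] -/
theorem isOpenCompact_map (e : G ≃ₜ* G') {K : Subgroup G} (hK : IsOpenCompact K) :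
    IsOpenCompact (K.map e.toMulEquiv.toMonoidHom) := by
  let h : G ≃ₜ G' := e.toHomeomorph
  have hset : ((K.map e.toMulEquiv.toMonoidHom : Subgroup G') : Set G') = h '' (K : Set G) := rfl
  refine ⟨?_, ?_⟩
  · rw [hset]; exact h.isOpenMap _ hK.1
  · rw [hset]; exact hK.2.image h.continuous

/-- Cofinality of a level family among the open compact subgroups transports along `e : G ≃ₜ* G'`. [folklore] -/
theorem cofinal_comap (e : G ≃ₜ* G') {Lvl : Type v} {Kof : Lvl → Subgroup G'}
    (hcof : ∀ K₀ : Subgroup G', IsOpenCompact K₀ → ∃ K₁ : Lvl, Kof K₁ ≤ K₀)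
    (K₀ : Subgroup G) (hK₀ : IsOpenCompact K₀) :
    ∃ K₁ : Lvl, (Kof K₁).comap e.toMulEquiv.toMonoidHom ≤ K₀ := by
  obtain ⟨K₁, hK₁⟩ := hcof _ (isOpenCompact_map e hK₀)
  refine ⟨K₁, (Subgroup.comap_mono hK₁).trans_eq ?_⟩
  exact Subgroup.comap_map_eq_self_of_injective (f := e.toMulEquiv.toMonoidHom) (fun a b h => e.injective h) K₀

end OpenCompact

/-! ## §1. The adapter along `eG : D.G ≃ₜ* G'` -/

section Along

variable {F E : Type} [Field F] [NumberField F] [IsTotallyReal F] [Field E] [NumberField E] [Algebra F E]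
  [IsTotallyComplex E] [Algebra.IsQuadraticExtension F E]

/-- **«Thm. 4.18 realised at `μ`» from Thm. 4.18 AS PRINTED, along a group identification.**  For a record `T` over ANY
topological group `G'` identified with Liu's `D.G` by a displayed `eG : D.G ≃ₜ* G'` ([Liu2021] App. C l. 4624: the fixed
`𝔾(𝔸_F^∞) ≅ U(V)(𝔸_F^∞)`), the summand identification `ψ` an injective `ℂ`-linear map intertwining `of (eG g) •` with the
componentwise `D.rhoAt · g`, the (4.3)-carrier `J` intertwining `(rhoΩ g) ⊗ 1` with `of (eG g) •`, and the class pin `hpin` at the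
pulled-back levels `eG⁻¹(Kof K)`.  KERNEL: `g := J ∘ Φ⁻¹ ∘ ψ` is `ℂ[G']`-linear (every `g' : G'` is `eG g`) and injective; generation by
pin-3's `resW_mem_span_of_fixed_of_thm418AsPrinted_act` at `Kof' K := eG⁻¹(Kof K)` (open compact, monotone, cofinal by §0) and
`act g x := of (eG g) • x`. [cite: Liu2021, Thm. 4.18, Thm. 4.18 (1), (4.3)] -/
theorem thm418Realised_of_asPrinted_along (D : Thm418Data F E) {G' : Type} [Group G'] [TopologicalSpace G']
    (eG : D.G ≃ₜ* G') {Lvl : Type v} [Preorder Lvl] {Kof : Lvl → Subgroup G'} {T : LiuAlbaneseModuleDatum G' Kof}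
    {W : Lvl → Type w} [∀ K, AddCommGroup (W K)] [∀ K, Module ℂ (W K)]
    {res : ∀ K : Lvl, T.H →ₗ[ℂ] W K} {cmCl : ∀ K : Lvl, T.Char → Set (W K)} {μ : T.Char}
    (hLiu : Thm418AsPrinted D)
    (hmono : ∀ ⦃K K' : Lvl⦄, K ≤ K' → Kof K ≤ Kof K') (hoc : ∀ K : Lvl, IsOpenCompact (Kof K))
    (hcof : ∀ K₀ : Subgroup G', IsOpenCompact K₀ → ∃ K₁ : Lvl, Kof K₁ ≤ K₀)
    (ψ : (⨁ a : T.Adm μ, T.Ω μ a) →ₗ[ℂ] ⨁ i : D.AdmIndex, D.omegaAt i) (hψinj : Function.Injective ψ)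
    (hψ : ∀ (g : D.G) (y : ⨁ a : T.Adm μ, T.Ω μ a) (i : D.AdmIndex),
      ψ (MonoidAlgebra.of ℂ G' (eG g) • y) i = D.rhoAt i g (ψ y i))
    (J : ℂ ⊗[fieldOfValues E D.μ] D.Ω →ₗ[ℂ] T.H) (hJinj : Function.Injective J)
    (hJ : ∀ (g : D.G) (x : ℂ ⊗[fieldOfValues E D.μ] D.Ω),
      J ((D.rhoΩ g).baseChange ℂ x) = MonoidAlgebra.of ℂ G' (eG g) • J x)
    (Dμ : D.Obj)
    (hpin : ∀ (K : Lvl) (φ : D.HomK ((Kof K).comap eG.toMulEquiv.toMonoidHom) Dμ),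
      res K (J ((1 : ℂ) ⊗ₜ[fieldOfValues E D.μ] D.res ((Kof K).comap eG.toMulEquiv.toMonoidHom) Dμ φ)) ∈ cmCl K μ) :
    ∃ g : (⨁ a : T.Adm μ, T.Ω μ a) →ₗ[MonoidAlgebra ℂ G'] T.H, Function.Injective g ∧
      ∃ K₀ : Lvl, ∀ K ≤ K₀, ∀ y, g y ∈ fixedBy (Kof K) T.H → res K (g y) ∈ Submodule.span ℂ (cmCl K μ) := by
  obtain ⟨Φ, hΦ, -, -, -⟩ := id hLiu
  let g₀ : (⨁ a : T.Adm μ, T.Ω μ a) →ₗ[ℂ] T.H := J ∘ₗ (Φ.symm.toLinearMap ∘ₗ ψ)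
  have hg₀ : ∀ y, g₀ y = J (Φ.symm (ψ y)) := fun _ => rfl
  have hsymm : ∀ (g : D.G) (y : ⨁ a : T.Adm μ, T.Ω μ a),
      (D.rhoΩ g).baseChange ℂ (Φ.symm (ψ y)) = Φ.symm (ψ (MonoidAlgebra.of ℂ G' (eG g) • y)) := by
    intro g y
    apply Φ.injective
    rw [LinearEquiv.apply_symm_apply]
    refine DFinsupp.ext fun i => ?_
    rw [hΦ, LinearEquiv.apply_symm_apply, hψ]
  have hcomm : ∀ (g' : G') (y : ⨁ a : T.Adm μ, T.Ω μ a),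
      g₀ (MonoidAlgebra.single g' (1 : ℂ) • y) = MonoidAlgebra.single g' (1 : ℂ) • g₀ y := by
    intro g' y
    obtain ⟨g, rfl⟩ := eG.surjective g'
    rw [← MonoidAlgebra.of_apply, hg₀, hg₀, ← hsymm, hJ]
  let g : (⨁ a : T.Adm μ, T.Ω μ a) →ₗ[MonoidAlgebra ℂ G'] T.H := MonoidAlgebra.equivariantOfLinearOfComm g₀ hcomm
  have hg : ∀ y, g y = J (Φ.symm (ψ y)) := fun _ => rfl
  -- generation, at the pulled-back levels `eG⁻¹(Kof K)`
  let Kof' : Lvl → Subgroup D.G := fun K => (Kof K).comap eG.toMulEquiv.toMonoidHom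
  have hmono' : ∀ ⦃K K' : Lvl⦄, K ≤ K' → Kof' K ≤ Kof' K' := fun K K' h => Subgroup.comap_mono (hmono h)
  have hoc' : ∀ K : Lvl, IsOpenCompact (Kof' K) := fun K => isOpenCompact_comap eG (hoc K)
  have hcof' : ∀ K₀ : Subgroup D.G, IsOpenCompact K₀ → ∃ K₁ : Lvl, Kof' K₁ ≤ K₀ := cofinal_comap eG hcof
  obtain ⟨K₀, hK₀⟩ := Thm418Data.resW_mem_span_of_fixed_of_thm418AsPrinted_act hLiu Dμ Kof' hmono' hoc' hcof'
    (fun (g : D.G) (x : T.H) => MonoidAlgebra.of ℂ G' (eG g) • x) res (fun K => cmCl K μ) J hJ hJinj hpin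
  refine ⟨g, hJinj.comp (Φ.symm.injective.comp hψinj), K₀, fun K hKle y hfix => ?_⟩
  rw [hg]
  exact hK₀ K hKle (Φ.symm (ψ y)) fun k hk => by rw [← hg]; exact hfix (eG k) hk

/-! ## §2. The summand identification along `eG` from per-summand data -/

/-- **The junction's `ψ` along `eG` from per-summand identifications**: an injective re-indexing `σ` and `ℂ`-linear identifications
`e a : ω_T(μ,a) ≃ ω_D(σ a)` intertwining `of (eG g) •` with `D.rhoAt (σ a) g` assemble to an injective `ℂ`-linear
`ψ : ⨁_a ω_T(μ,a) → ⨁_i ω_D(i)` with the equivariance `thm418Realised_of_asPrinted_along` asks and `ψ (ι_a m) = ι_{σ a} (e a m)`.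
[folklore] -/
theorem exists_sumEmbedding_along (D : Thm418Data F E) [DecidableEq D.AdmIndex] {G' : Type} [Group G']
    (eG : D.G → G') {Lvl : Type v} {Kof : Lvl → Subgroup G'}
    (T : LiuAlbaneseModuleDatum G' Kof) (μ : T.Char) [DecidableEq (T.Adm μ)]
    (σ : T.Adm μ → D.AdmIndex) (hσ : Function.Injective σ)
    (e : ∀ a : T.Adm μ, T.Ω μ a ≃ₗ[ℂ] D.omegaAt (σ a))
    (he : ∀ (a : T.Adm μ) (g : D.G) (m : T.Ω μ a), e a (MonoidAlgebra.of ℂ G' (eG g) • m) = D.rhoAt (σ a) g (e a m)) :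
    ∃ ψ : (⨁ a : T.Adm μ, T.Ω μ a) →ₗ[ℂ] ⨁ i : D.AdmIndex, D.omegaAt i,
      Function.Injective ψ ∧
      (∀ (g : D.G) (y : ⨁ a : T.Adm μ, T.Ω μ a) (i : D.AdmIndex),
        ψ (MonoidAlgebra.of ℂ G' (eG g) • y) i = D.rhoAt i g (ψ y i)) ∧
      (∀ (a : T.Adm μ) (m : T.Ω μ a),
        ψ (DirectSum.lof ℂ (T.Adm μ) (fun a => T.Ω μ a) a m) = DirectSum.lof ℂ D.AdmIndex D.omegaAt (σ a) (e a m)) := by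
  let ψ : (⨁ a : T.Adm μ, T.Ω μ a) →ₗ[ℂ] ⨁ i : D.AdmIndex, D.omegaAt i :=
    DirectSum.toModule ℂ (T.Adm μ) (⨁ i : D.AdmIndex, D.omegaAt i)
      fun a => DirectSum.lof ℂ D.AdmIndex D.omegaAt (σ a) ∘ₗ (e a).toLinearMap
  have hψlof : ∀ (a : T.Adm μ) (m : T.Ω μ a),
      ψ (DirectSum.lof ℂ (T.Adm μ) (fun a => T.Ω μ a) a m) = DirectSum.lof ℂ D.AdmIndex D.omegaAt (σ a) (e a m) := by
    intro a m
    simp only [ψ, DirectSum.toModule_lof, LinearMap.coe_comp, LinearEquiv.coe_coe, Function.comp_apply]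
  have hcomp : ∀ (y : ⨁ a : T.Adm μ, T.Ω μ a) (a : T.Adm μ), ψ y (σ a) = e a (y a) := by
    intro y a
    induction y using DirectSum.induction_on with
    | zero => simp only [map_zero, DirectSum.zero_apply]
    | of b m =>
      rw [← DirectSum.lof_eq_of ℂ, hψlof, DirectSum.lof_eq_of, DirectSum.lof_eq_of]
      by_cases hba : b = a
      · subst hba
        rw [DirectSum.of_eq_same, DirectSum.of_eq_same]
      · rw [DirectSum.of_eq_of_ne _ _ _ (fun h => hba (hσ h).symm), DirectSum.of_eq_of_ne _ _ _ (Ne.symm hba), map_zero]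
    | add y z hy hz => simp only [map_add, DirectSum.add_apply, hy, hz]
  refine ⟨ψ, fun y y' hyy' => ?_, fun g y i => ?_, hψlof⟩
  · refine DFinsupp.ext fun a => (e a).injective ?_
    rw [← hcomp, ← hcomp, hyy']
  · induction y using DirectSum.induction_on with
    | zero => simp only [smul_zero, map_zero, DirectSum.zero_apply]
    | of a m =>
      have hsm : MonoidAlgebra.of ℂ G' (eG g) • DirectSum.lof ℂ (T.Adm μ) (fun a => T.Ω μ a) a m =
          DirectSum.lof ℂ (T.Adm μ) (fun a => T.Ω μ a) a (MonoidAlgebra.of ℂ G' (eG g) • m) :=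
        ((DirectSum.lof (MonoidAlgebra ℂ G') (T.Adm μ) (fun a => T.Ω μ a) a).map_smul (MonoidAlgebra.of ℂ G' (eG g)) m).symm
      rw [← DirectSum.lof_eq_of ℂ, hsm, hψlof, hψlof, he, DirectSum.lof_eq_of, DirectSum.lof_eq_of]
      by_cases hi : i = σ a
      · subst hi
        rw [DirectSum.of_eq_same, DirectSum.of_eq_same]
      · rw [DirectSum.of_eq_of_ne _ _ _ hi, DirectSum.of_eq_of_ne _ _ _ hi, map_zero]
    | add y z hy hz => simp only [smul_add, map_add, DirectSum.add_apply, hy, hz]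

/-- **«Thm. 4.18 realised at `μ`» along `eG` from Thm. 4.18 AS PRINTED and PER-SUMMAND identifications** (`σ` injective,
`e a` equivariant along `eG`), the (4.3)-carrier `J` and the class pin at the pulled-back levels.
[cite: Liu2021, Thm. 4.18, Thm. 4.18 (1), (4.3)] -/
theorem thm418Realised_of_asPrinted_along_summands (D : Thm418Data F E) {G' : Type} [Group G'] [TopologicalSpace G']
    (eG : D.G ≃ₜ* G') {Lvl : Type v} [Preorder Lvl] {Kof : Lvl → Subgroup G'} {T : LiuAlbaneseModuleDatum G' Kof}
    {W : Lvl → Type w} [∀ K, AddCommGroup (W K)] [∀ K, Module ℂ (W K)]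
    {res : ∀ K : Lvl, T.H →ₗ[ℂ] W K} {cmCl : ∀ K : Lvl, T.Char → Set (W K)} {μ : T.Char}
    (hLiu : Thm418AsPrinted D)
    (hmono : ∀ ⦃K K' : Lvl⦄, K ≤ K' → Kof K ≤ Kof K') (hoc : ∀ K : Lvl, IsOpenCompact (Kof K))
    (hcof : ∀ K₀ : Subgroup G', IsOpenCompact K₀ → ∃ K₁ : Lvl, Kof K₁ ≤ K₀)
    (σ : T.Adm μ → D.AdmIndex) (hσ : Function.Injective σ)
    (e : ∀ a : T.Adm μ, T.Ω μ a ≃ₗ[ℂ] D.omegaAt (σ a))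
    (he : ∀ (a : T.Adm μ) (g : D.G) (m : T.Ω μ a), e a (MonoidAlgebra.of ℂ G' (eG g) • m) = D.rhoAt (σ a) g (e a m))
    (J : ℂ ⊗[fieldOfValues E D.μ] D.Ω →ₗ[ℂ] T.H) (hJinj : Function.Injective J)
    (hJ : ∀ (g : D.G) (x : ℂ ⊗[fieldOfValues E D.μ] D.Ω),
      J ((D.rhoΩ g).baseChange ℂ x) = MonoidAlgebra.of ℂ G' (eG g) • J x)
    (Dμ : D.Obj)
    (hpin : ∀ (K : Lvl) (φ : D.HomK ((Kof K).comap eG.toMulEquiv.toMonoidHom) Dμ),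
      res K (J ((1 : ℂ) ⊗ₜ[fieldOfValues E D.μ] D.res ((Kof K).comap eG.toMulEquiv.toMonoidHom) Dμ φ)) ∈ cmCl K μ) :
    ∃ g : (⨁ a : T.Adm μ, T.Ω μ a) →ₗ[MonoidAlgebra ℂ G'] T.H, Function.Injective g ∧
      ∃ K₀ : Lvl, ∀ K ≤ K₀, ∀ y, g y ∈ fixedBy (Kof K) T.H → res K (g y) ∈ Submodule.span ℂ (cmCl K μ) := by
  classical
  obtain ⟨ψ, hψinj, hψ, -⟩ := exists_sumEmbedding_along D eG T μ σ hσ e he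
  exact thm418Realised_of_asPrinted_along D eG hLiu hmono hoc hcof ψ hψinj hψ J hJinj hJ Dμ hpin

/-- `ω_T(μ,a) ≠ 0` from `ω_D(σ a) ≠ 0` along the identification (group-independent; restated here for the `G'`-typed record).
[folklore] -/
theorem nontrivial_Ω_of_summand_equiv_along (D : Thm418Data F E) {G' : Type} [Group G'] {Lvl : Type v}
    {Kof : Lvl → Subgroup G'} (T : LiuAlbaneseModuleDatum G' Kof) {μ : T.Char} (σ : T.Adm μ → D.AdmIndex)
    (e : ∀ a : T.Adm μ, T.Ω μ a ≃ₗ[ℂ] D.omegaAt (σ a))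
    (hnvD : ∀ i : D.AdmIndex, Nontrivial (D.omegaAt i)) (a : T.Adm μ) : Nontrivial (T.Ω μ a) :=
  haveI := hnvD (σ a)
  (e a).toEquiv.nontrivial

end Along

end LiuAlbaneseModuleDatum

end HodgeCM.Literature.Theta

end
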